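import Mathlib.InformationTheory.KullbackLeibler.Basic
import Mathlib.MeasureTheory.Measure.Haar.InnerProductSpace
import Mathlib.Data.Real.ENatENNReal
import Mathlib.Order.LiminfLimsup
import Literature.Analysis.FluidPDE.InfiniteHardSphereFlow
import HarnessLib

/-!
# Specific relative entropy, intensity, specific kinetic energy of states of marked configurations

Topic `MathematicalPhysics/StatisticalMechanics`; namespace
`Literature.MathematicalPhysics.StatisticalMechanics`.  DEFINITIONS answering the request
`defn-specificRelativeEntropy` (wanted by item stmt-AtomisticToContinuum-0779 `GibbsErgodicity`,
route VanishingNoise item 0813 and the cards pesin-defect-u-gibbs-rigidity,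
ld-drude-flux-gibbsianity, ybg-hard-core-rigidity, onboard-sinai-accessibility): the
per-unit-volume relative entropy,
particle density and kinetic energy of a state `ν` (a law on configurations) of marked point
configurations `ω : PointConfig (ℝ^d × ℝ^d)` (positions × velocities) in GENERAL dimension, on the
configuration type of `Literature.Analysis.FluidPDE.InfiniteHardSphereFlow` /
`Literature.Analysis.FluidPDE.IsHardSphereGibbs` (`d : Type*`, `[Fintype d]`, count σ-algebra of
`Literature.Analysis.FunctionSpaces.PointConfig`), relative to an arbitrary reference law `μ`
(a hard-sphere Gibbs state `IsHardSphereGibbs ε z β u μ`, or the free gas = Poisson process with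
intensity `z · Leb ⊗ Maxwellian`):

* `window Λ = Λ ×ˢ univ` (all phase points with position in `Λ ⊆ ℝ^d`); the WINDOW MARGINAL
  `windowLaw Λ ν = ν ∘ (ω ↦ ω ∩ window Λ)⁻¹` (`PointConfig.restrict`, measurable for measurable
  `Λ`);
  the WINDOW RELATIVE ENTROPY `windowRelEntropy Λ ν μ = H_Λ(ν | μ) := KL(ν_Λ ‖ μ_Λ)` (Mathlib
  `InformationTheory.klDiv`, `= ∞` off absolute continuity / integrability) — Georgii–Zessin 1993
  §2.3 `I(P_Λ; Q_Λ)`, Liverani–Olla 1996 (1.6) `H_Λ(Q|P)`, Ruelle 1969 (2.21) (`= -S(Λ)` for the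
  unit Poisson reference);
* open boxes `box a b = ∏ᵢ (aᵢ, bᵢ)` and cubes `cube r = (-r, r)^d` with their volumes
  (`volume_box`, `volume_cube`), the half-open unit cell `unitCube = [0, 1)^d` (`volume_unitCube`);
* `specificRelativeEntropy ν μ := limsup_{n → ∞} H_{Λ_n}(ν | μ) / |Λ_n|` along the cubes
  `Λ_n = (-n, n)^d`, `ℝ≥0∞`-valued.  It is a `limsup` and needs no existence theorem; for a
  translation-invariant `ν` of locally finite intensity and the FREE reference the limit exists and
  equals the supremum over all open cubes — vendored as the named fact
  `GeorgiiZessin1993_specificEntropy` (Georgii–Zessin 1993 (2.12) and Remark 2.5 (1); unmarked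
  original: Robinson–Ruelle 1967, Ruelle 1969 Prop. 7.2.7 "the following limit exists when `Λ → ∞`
  in the sense of Van Hove"; Dereudre 2019 §2.1 with the closed cubes `[-n, n]^d`);
* `HasFiniteSpecificEntropy ν μ :↔ ∃ C, ∀ open boxes Λ, H_Λ(ν | μ) ≤ C |Λ|` — the hypothesis "finite
  entropy density" in the form the ergodic theorems consume (Liverani–Olla 1996 Thm 1.2 (i): "There
  exists a constant `C` such that for each box `Λ`, `H_Λ(Q|P) ≤ C|Λ|`"; Fritz–Funaki–Lebowitz 1994
  §1; Olla–Varadhan–Yau 1993 §2), with `HasFiniteSpecificEntropy.specificRelativeEntropy_lt_top` and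
  `HasFiniteSpecificEntropy.of_forall_isBounded` (the version over all bounded measurable regions
  implies it);
* `intensity ν = E_ν[#{particles with position in [0,1)^d}]`, `HasLocallyFiniteIntensity ν`
  (finite expected particle number in every bounded region: Georgii–Zessin's "first order"),
  `kineticEnergyIn Λ ω = Σ_{(q,v) ∈ ω, q ∈ Λ} ‖v‖²/2` and
  `specificKineticEnergy ν = E_ν[kineticEnergyIn [0,1)^d]`, all `ℝ≥0∞`-valued (mass `1`).
  Translation invariance is the tree's `Literature.Analysis.FluidPDE.IsTranslationInvariant`.

## Design / junk values

* `windowLaw Λ ν = 0` if `Λ` is not measurable (Mathlib's `Measure.map` along a non-measurable map);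
  all uses are with measurable `Λ`.  `H / |Λ|` is `ENNReal` division (`x / 0 = ∞` for `x ≠ 0`,
  `0 / 0 = 0`, `x / ∞ = 0`); the cube `Λ_0 = ∅` contributes `0 / 0 = 0`, irrelevant for `limsup` /
  `Tendsto` along `atTop`.
* `PointConfig (ℝ^d × ℝ^d)` asks local finiteness in PHASE space only, so a window may contain
  infinitely many particles (`count = ⊤ ↦ ∞`, `kineticEnergyIn` a `tsum` in `ℝ≥0∞`); states of
  locally finite intensity are carried by spatially locally finite configurations, the configuration
  space of Georgii–Zessin 1993 §2.1.
* Boxes are OPEN (Georgii–Zessin's class `𝒞` of open cubes; Ruelle's "bounded open region");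
  `HasFiniteSpecificEntropy` quantifies over non-degenerate open boxes (`aᵢ < bᵢ`), as printed in
  Liverani–Olla 1996 ("for each box"), not over all bounded measurable sets.
* The `d = 3` hard-sphere file `HardSphereGibbs.lean` has `HardSphere.relEntropyIn` /
  `HardSphere.specificRelEntropy` with CLOSED cubes `[-(n+1), n+1]³`; the present file is the
  general-`d` notion on the configuration type of the infinite dynamics (`InfiniteHardSphereFlow`);
  no compatibility lemma is claimed (the two agree for states of locally finite intensity, since
  cube boundaries are Lebesgue-null, but not definitionally).

NOT here: existence of the limit relative to an INTERACTING Gibbs reference (Georgii 1994/1995 for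
superstable pair potentials, via `h(P | μ) = I(P) + β e(P) + p(β, z)` for tempered `P`), lower
semicontinuity / compactness of level sets (Georgii–Zessin 1993 Prop. 2.6), affinity, the
variational principle, and any data-processing monotonicity of `H_Λ` in `Λ` (Mathlib has no
`klDiv` data-processing lemma at this pin).

## References

* H.-O. Georgii, H. Zessin, *Large deviations and the maximum entropy principle for marked point
  random fields*, PTRF 96 (1993) 177–204, §2.1 (pp. 179–180), §2.3 (2.10)–(2.13), Remark 2.5,
  Prop. 2.6 (p. 184). [GeorgiiZessin1993]
* D. W. Robinson, D. Ruelle, *Mean entropy of states in classical statistical mechanics*, Comm.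
  Math. Phys. 5 (1967) 288–300. [RobinsonRuelle1967]
* D. Ruelle, *Statistical Mechanics: Rigorous Results* (1969), §7.2.5–7.2.8 (PDF p. 160).
  [Ruelle1969]
* C. Liverani, S. Olla, *Ergodicity in infinite Hamiltonian systems with conservative noise*, PTRF
  106 (1996) 401–445, (1.6) and Thm 1.2 (i) (pp. 407–409). [LiveraniOlla1996]
* J. Fritz, T. Funaki, J. L. Lebowitz, PTRF 99 (1994), §1. [FritzFunakiLebowitz1994]
* S. Olla, S. R. S. Varadhan, H.-T. Yau, Comm. Math. Phys. 155 (1993), §2. [OllaVaradhanYau1993]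
* D. Dereudre, *Introduction to the theory of Gibbs point processes* (2019), §2.1. [Dereudre2019]
-/

noncomputable section

open MeasureTheory Set Filter Bornology
open scoped ENNReal NNReal Topology
open Literature.Analysis.FunctionSpaces Literature.Analysis.FluidPDE

namespace Literature.MathematicalPhysics.StatisticalMechanics

variable {d : Type*}

local notation "𝔼" => EuclideanSpace ℝ d

/-! ## Part A — windows, marginals, entropies in a window (any index type `d`) -/

/-! ### Windows and window marginals -/

/-- The *window* over the spatial region `Λ ⊆ ℝ^d`: all phase points `(q, v)` with position
`q ∈ Λ`, any velocity (`Λ × E` of Georgii–Zessin 1993 §2.1, mark space `E = ℝ^d`).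
[cite: GeorgiiZessin1993, §2.1] -/
def window (Λ : Set 𝔼) : Set (𝔼 × 𝔼) := Λ ×ˢ univ

/-- Membership in a window is membership of the position. [folklore] -/
@[simp] theorem mem_window {Λ : Set 𝔼} {x : 𝔼 × 𝔼} : x ∈ window Λ ↔ x.1 ∈ Λ := by
  simp [window]

/-- Windows over measurable regions are measurable. [folklore] -/
theorem measurableSet_window {Λ : Set 𝔼} (hΛ : MeasurableSet Λ) : MeasurableSet (window Λ) :=
  hΛ.prod MeasurableSet.univ

/-- Windows are monotone in the region. [folklore] -/
theorem window_mono {Λ Λ' : Set 𝔼} (h : Λ ⊆ Λ') : window Λ ⊆ window Λ' :=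
  prod_mono h Subset.rfl

/-- The *window marginal* `ν_Λ` of a law `ν` on configurations: the law of the restricted
configuration `ω ∩ (Λ × ℝ^d)` (Georgii–Zessin 1993 §2.3: "`P_Λ = P ∘ r_Λ⁻¹` the projection onto
`(Ω_Λ, ℱ_Λ)`"; Liverani–Olla 1996 §1: "their restrictions on a finite box `Λ`").  Junk value `0` if
`Λ` is not measurable. [cite: GeorgiiZessin1993, §2.3] -/
def windowLaw (Λ : Set 𝔼) (ν : Measure (PointConfig (𝔼 × 𝔼))) : Measure (PointConfig (𝔼 × 𝔼)) :=
  ν.map (PointConfig.restrict (window Λ))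

/-- Unfolding lemma for `windowLaw`. [folklore] -/
theorem windowLaw_def (Λ : Set 𝔼) (ν : Measure (PointConfig (𝔼 × 𝔼))) :
    windowLaw Λ ν = ν.map (PointConfig.restrict (window Λ)) :=
  rfl

/-- The window marginal of an event is the `ν`-measure of its preimage under restriction.
[folklore] -/
theorem windowLaw_apply {Λ : Set 𝔼} (hΛ : MeasurableSet Λ) (ν : Measure (PointConfig (𝔼 × 𝔼)))
    {A : Set (PointConfig (𝔼 × 𝔼))} (hA : MeasurableSet A) :
    windowLaw Λ ν A = ν (PointConfig.restrict (window Λ) ⁻¹' A) :=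
  Measure.map_apply (PointConfig.measurable_restrict (measurableSet_window hΛ)) hA

/-- The window marginal of a finite law is finite. [folklore] -/
instance isFiniteMeasure_windowLaw (Λ : Set 𝔼) (ν : Measure (PointConfig (𝔼 × 𝔼)))
    [IsFiniteMeasure ν] : IsFiniteMeasure (windowLaw Λ ν) := by
  unfold windowLaw; infer_instance

/-- The window marginal of a state over a measurable region is a probability measure. [folklore] -/
theorem isProbabilityMeasure_windowLaw {Λ : Set 𝔼} (hΛ : MeasurableSet Λ)
    (ν : Measure (PointConfig (𝔼 × 𝔼))) [IsProbabilityMeasure ν] :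
    IsProbabilityMeasure (windowLaw Λ ν) :=
  Measure.isProbabilityMeasure_map
    (PointConfig.measurable_restrict (measurableSet_window hΛ)).aemeasurable

/-! ### Window relative entropy -/

/-- **Relative entropy of `ν` with respect to `μ` in the window over `Λ`**:
`H_Λ(ν | μ) := KL(ν_Λ ‖ μ_Λ) ∈ [0, ∞]`, the Kullback–Leibler divergence of the window marginals
(Mathlib `InformationTheory.klDiv`: `∫ log (dν_Λ/dμ_Λ) dν_Λ` if `ν_Λ ≪ μ_Λ` with integrable
log-likelihood ratio, `+∞` otherwise; Georgii–Zessin 1993 (2.10) `I(P_Λ; Q_Λ)`; Liverani–Olla 1996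
(1.6) `H_Λ(Q|P) = sup_F {E_Q(F) - log E_P(e^F)}`; `-S(Λ)` of Ruelle 1969 (2.21) when `μ` is the unit
Poisson process). [cite: GeorgiiZessin1993, §2.3 (2.10)] -/
def windowRelEntropy (Λ : Set 𝔼) (ν μ : Measure (PointConfig (𝔼 × 𝔼))) : ℝ≥0∞ :=
  InformationTheory.klDiv (windowLaw Λ ν) (windowLaw Λ μ)

/-- Unfolding lemma for `windowRelEntropy`. [folklore] -/
theorem windowRelEntropy_def (Λ : Set 𝔼) (ν μ : Measure (PointConfig (𝔼 × 𝔼))) :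
    windowRelEntropy Λ ν μ = InformationTheory.klDiv (windowLaw Λ ν) (windowLaw Λ μ) :=
  rfl

/-- `H_Λ(ν | ν) = 0` for a finite law (Georgii–Zessin 1993 §2.3: "`I(α; β) ≥ 0` with equality if and
only if `α = β`"). [cite: GeorgiiZessin1993, §2.3] -/
@[simp] theorem windowRelEntropy_self (Λ : Set 𝔼) (ν : Measure (PointConfig (𝔼 × 𝔼)))
    [IsFiniteMeasure ν] : windowRelEntropy Λ ν ν = 0 :=
  InformationTheory.klDiv_self _

/-! ### Boxes, cubes, the unit cell -/

/-- The open box `∏ᵢ (aᵢ, bᵢ) ⊆ ℝ^d` (empty unless `aᵢ < bᵢ` for all `i`); Georgii–Zessin's class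
`𝒞` consists of the open cubes `∏ᵢ (qᵢ, qᵢ + p)`, `p > 0`. [cite: GeorgiiZessin1993, §2.1] -/
def box (a b : d → ℝ) : Set 𝔼 := {q | ∀ i, q i ∈ Ioo (a i) (b i)}

/-- Membership in a box, coordinatewise. [folklore] -/
@[simp] theorem mem_box {a b : d → ℝ} {q : 𝔼} : q ∈ box a b ↔ ∀ i, q i ∈ Ioo (a i) (b i) :=
  Iff.rfl

/-- A box is the preimage of the corresponding coordinate box of `d → ℝ` under the (measure
preserving) identification `EuclideanSpace ℝ d ≃ (d → ℝ)`. [folklore] -/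
theorem box_eq_preimage (a b : d → ℝ) :
    box a b = (WithLp.ofLp : 𝔼 → d → ℝ) ⁻¹' Set.pi univ fun i => Ioo (a i) (b i) := by
  ext q
  simp [box]

/-- The open cube `Λ(r) = (-r, r)^d` centred at the origin (empty for `r ≤ 0` unless `d` is empty).
[folklore] -/
def cube (r : ℝ) : Set 𝔼 := box (fun _ => -r) (fun _ => r)

/-- Unfolding lemma for `cube`. [folklore] -/
theorem cube_def (r : ℝ) : (cube r : Set 𝔼) = box (fun _ => -r) (fun _ => r) := rfl

/-- The half-open unit cell `[0, 1)^d`, a fundamental domain for the translations by `ℤ^d`; used to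
normalise per-unit-volume quantities. [folklore] -/
def unitCube : Set 𝔼 := {q | ∀ i, q i ∈ Ico (0 : ℝ) 1}

/-- Membership in the unit cell, coordinatewise. [folklore] -/
@[simp] theorem mem_unitCube {q : 𝔼} : q ∈ (unitCube : Set 𝔼) ↔ ∀ i, q i ∈ Ico (0 : ℝ) 1 :=
  Iff.rfl

/-- The unit cell as a preimage of the coordinate unit cell of `d → ℝ`. [folklore] -/
theorem unitCube_eq_preimage :
    (unitCube : Set 𝔼) = (WithLp.ofLp : 𝔼 → d → ℝ) ⁻¹' Set.pi univ fun _ => Ico (0 : ℝ) 1 := by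
  ext q
  simp [unitCube]

/-! ### Particle numbers in windows; intensity -/

/-- The particle number in a window, as an `ℝ≥0∞`-valued measurable function of the configuration.
[folklore] -/
theorem measurable_count_window {Λ : Set 𝔼} (hΛ : MeasurableSet Λ) :
    Measurable fun ω : PointConfig (𝔼 × 𝔼) => ((ω.count (window Λ) : ℕ∞) : ℝ≥0∞) :=
  measurable_from_top.comp (PointConfig.measurable_count (measurableSet_window hΛ))

/-- **Intensity** (particle density) of the law `ν`: the expected number of particles with position
in the unit cell `[0, 1)^d` (any velocity), in `[0, ∞]`.  For a translation-invariant `ν` this is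
the constant `z(P)` with `E_ν N_Λ = z(P) |Λ|` for all Borel `Λ` (Georgii–Zessin 1993 §2.1).
[cite: GeorgiiZessin1993, §2.1] -/
def intensity (ν : Measure (PointConfig (𝔼 × 𝔼))) : ℝ≥0∞ :=
  ∫⁻ ω, ((ω.count (window unitCube) : ℕ∞) : ℝ≥0∞) ∂ν

/-- Unfolding lemma for `intensity`. [folklore] -/
theorem intensity_def (ν : Measure (PointConfig (𝔼 × 𝔼))) :
    intensity ν = ∫⁻ ω, ((ω.count (window unitCube) : ℕ∞) : ℝ≥0∞) ∂ν :=
  rfl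

/-! ## Part B — volumes, specific quantities, the named fact (`d` finite) -/

section Finite

variable [Fintype d]

/-! ### Topology and volume of boxes, cubes, the unit cell -/

/-- Boxes are open. [folklore] -/
theorem isOpen_box (a b : d → ℝ) : IsOpen (box a b : Set 𝔼) := by
  rw [box_eq_preimage]
  exact (isOpen_set_pi finite_univ fun i _ => isOpen_Ioo).preimage
    (PiLp.continuous_ofLp 2 fun _ : d => ℝ)

/-- Boxes are measurable. [folklore] -/
theorem measurableSet_box (a b : d → ℝ) : MeasurableSet (box a b : Set 𝔼) :=
  (isOpen_box a b).measurableSet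

/-- A set of `ℝ^d` whose coordinates are confined to bounded intervals is bounded (it lies in the
continuous image of the compact coordinate box). [folklore] -/
theorem isBounded_of_forall_mem_Icc {s : Set 𝔼} {a b : d → ℝ}
    (h : ∀ q ∈ s, ∀ i, q i ∈ Icc (a i) (b i)) : IsBounded s := by
  have hc : IsCompact ((WithLp.toLp 2 : (d → ℝ) → 𝔼) '' Icc a b) :=
    isCompact_Icc.image (PiLp.continuous_toLp 2 fun _ : d => ℝ)
  refine hc.isBounded.subset fun q hq =>
    ⟨WithLp.ofLp q, ⟨fun i => (h q hq i).1, fun i => (h q hq i).2⟩, ?_⟩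
  simp

/-- Boxes are bounded. [folklore] -/
theorem isBounded_box (a b : d → ℝ) : IsBounded (box a b : Set 𝔼) :=
  isBounded_of_forall_mem_Icc (a := a) (b := b) fun _ hq i => Ioo_subset_Icc_self (hq i)

/-- **Volume of a box**: `|∏ᵢ (aᵢ, bᵢ)| = ∏ᵢ (bᵢ - aᵢ)⁺` (Lebesgue measure on `EuclideanSpace ℝ d`
is the product measure transported along `EuclideanSpace ℝ d ≃ᵐ (d → ℝ)`). [folklore] -/
theorem volume_box (a b : d → ℝ) :
    volume (box a b : Set 𝔼) = ∏ i, ENNReal.ofReal (b i - a i) := by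
  rw [box_eq_preimage, (PiLp.volume_preserving_ofLp d).measure_preimage
    (MeasurableSet.univ_pi fun i => measurableSet_Ioo).nullMeasurableSet, Real.volume_pi_Ioo]

/-- Cubes are measurable. [folklore] -/
theorem measurableSet_cube (r : ℝ) : MeasurableSet (cube r : Set 𝔼) := measurableSet_box _ _

/-- Cubes are bounded. [folklore] -/
theorem isBounded_cube (r : ℝ) : IsBounded (cube r : Set 𝔼) := isBounded_box _ _

/-- **Volume of a cube**: `|(-r, r)^d| = (2r)^d` for `r ≥ 0` (and `0` for `r < 0`, `d` nonempty).
[folklore] -/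
theorem volume_cube (r : ℝ) :
    volume (cube r : Set 𝔼) = ENNReal.ofReal (2 * r) ^ Fintype.card d := by
  rw [cube_def, volume_box, Finset.prod_const, Finset.card_univ, sub_neg_eq_add, two_mul]

/-- Cubes of positive radius have positive finite volume. [folklore] -/
theorem volume_cube_ne_zero {r : ℝ} (hr : 0 < r) : volume (cube r : Set 𝔼) ≠ 0 := by
  rw [volume_cube]
  exact pow_ne_zero _ ((ENNReal.ofReal_pos.2 (by positivity)).ne')

/-- Cubes have finite volume. [folklore] -/
theorem volume_cube_ne_top (r : ℝ) : volume (cube r : Set 𝔼) ≠ ∞ := by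
  rw [volume_cube]
  exact ENNReal.pow_ne_top ENNReal.ofReal_ne_top

/-- The unit cell is measurable. [folklore] -/
theorem measurableSet_unitCube : MeasurableSet (unitCube : Set 𝔼) := by
  rw [unitCube_eq_preimage]
  exact (MeasurableSet.univ_pi fun _ => measurableSet_Ico).preimage
    (WithLp.measurable_ofLp 2 (d → ℝ))

/-- The unit cell is bounded. [folklore] -/
theorem isBounded_unitCube : IsBounded (unitCube : Set 𝔼) :=
  isBounded_of_forall_mem_Icc (a := fun _ => 0) (b := fun _ => 1)
    fun _ hq i => Ico_subset_Icc_self (hq i)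

/-- The unit cell has volume `1`. [folklore] -/
@[simp] theorem volume_unitCube : volume (unitCube : Set 𝔼) = 1 := by
  rw [unitCube_eq_preimage, (PiLp.volume_preserving_ofLp d).measure_preimage
    (MeasurableSet.univ_pi fun _ => measurableSet_Ico).nullMeasurableSet, Real.volume_pi_Ico]
  simp

/-! ### Specific relative entropy -/

/-- **Specific relative entropy** (relative entropy per unit volume) of the law `ν` with respect to
the reference law `μ`:
`s(ν | μ) := limsup_{n → ∞} H_{Λ_n}(ν | μ) / |Λ_n|` along the open cubes `Λ_n = (-n, n)^d`, with
values in `[0, ∞]` (Georgii–Zessin 1993 (2.12): `I(P) = lim_n |Λ_n|⁻¹ I(P_{Λ_n}; Q_{Λ_n})`, `Q` the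
Poisson field; Ruelle 1969 (2.25) `s = lim S(Λ)/V(Λ)`).  Defined as a `limsup`, so that no
existence theorem is needed; for translation-invariant `ν` of locally finite intensity and the free
(Poisson) reference the limit exists and the `limsup` is the limit
(`GeorgiiZessin1993_specificEntropy`).  Typical references `μ`: a hard-sphere Gibbs state
(`Literature.Analysis.FluidPDE.IsHardSphereGibbs`) or the ideal gas (Poisson process with intensity
`z · Leb ⊗ Maxwellian`). [cite: GeorgiiZessin1993, §2.3 (2.12)] -/
def specificRelativeEntropy (ν μ : Measure (PointConfig (𝔼 × 𝔼))) : ℝ≥0∞ :=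
  limsup (fun n : ℕ => windowRelEntropy (cube (n : ℝ)) ν μ / volume (cube (n : ℝ) : Set 𝔼)) atTop

/-- Unfolding lemma for `specificRelativeEntropy`. [folklore] -/
theorem specificRelativeEntropy_def (ν μ : Measure (PointConfig (𝔼 × 𝔼))) :
    specificRelativeEntropy ν μ =
      limsup (fun n : ℕ => windowRelEntropy (cube (n : ℝ)) ν μ / volume (cube (n : ℝ) : Set 𝔼))
        atTop :=
  rfl

/-- `s(ν | ν) = 0` for a finite law. [folklore] -/
@[simp] theorem specificRelativeEntropy_self (ν : Measure (PointConfig (𝔼 × 𝔼)))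
    [IsFiniteMeasure ν] : specificRelativeEntropy ν ν = 0 := by
  simp [specificRelativeEntropy]

/-! ### Finite specific entropy (the hypothesis of the ergodic theorems) -/

/-- **Finite specific entropy of `ν` relative to `μ`** in the form consumed by the ergodic theorems
for infinite systems: there is a constant `C` such that `H_Λ(ν | μ) ≤ C |Λ|` for every
(non-degenerate, open) box `Λ = ∏ᵢ (aᵢ, bᵢ)` (Liverani–Olla 1996 Thm 1.2 (i): "There exists a
constant `C` such that for each box `Λ`, `H_Λ(Q|P) ≤ C|Λ|`", `P` any grand-canonical Gibbs
measure; likewise Fritz–Funaki–Lebowitz 1994 §1, Olla–Varadhan–Yau 1993 §2).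
[cite: LiveraniOlla1996, Thm 1.2 (i)] -/
def HasFiniteSpecificEntropy (ν μ : Measure (PointConfig (𝔼 × 𝔼))) : Prop :=
  ∃ C : ℝ≥0, ∀ a b : d → ℝ, (∀ i, a i < b i) →
    windowRelEntropy (box a b) ν μ ≤ C * volume (box a b : Set 𝔼)

/-- Unfolding lemma for `HasFiniteSpecificEntropy`. [folklore] -/
theorem hasFiniteSpecificEntropy_iff (ν μ : Measure (PointConfig (𝔼 × 𝔼))) :
    HasFiniteSpecificEntropy ν μ ↔ ∃ C : ℝ≥0, ∀ a b : d → ℝ, (∀ i, a i < b i) →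
      windowRelEntropy (box a b) ν μ ≤ C * volume (box a b : Set 𝔼) :=
  Iff.rfl

/-- A finite law has finite specific entropy relative to itself (`C = 0`). [folklore] -/
theorem hasFiniteSpecificEntropy_self (ν : Measure (PointConfig (𝔼 × 𝔼))) [IsFiniteMeasure ν] :
    HasFiniteSpecificEntropy ν ν :=
  ⟨0, fun a b _ => by simp⟩

/-- The entropy bound over ALL bounded measurable regions (`H_Λ(ν | μ) ≤ C |Λ|` for every bounded
measurable `Λ ⊆ ℝ^d`) implies the box form. [folklore] -/
theorem HasFiniteSpecificEntropy.of_forall_isBounded {ν μ : Measure (PointConfig (𝔼 × 𝔼))}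
    (h : ∃ C : ℝ≥0, ∀ Λ : Set 𝔼, MeasurableSet Λ → IsBounded Λ →
      windowRelEntropy Λ ν μ ≤ C * volume Λ) :
    HasFiniteSpecificEntropy ν μ := by
  obtain ⟨C, hC⟩ := h
  exact ⟨C, fun a b _ => hC _ (measurableSet_box a b) (isBounded_box a b)⟩

/-- Finite specific entropy bounds the specific relative entropy by the same constant:
`s(ν | μ) ≤ C`. [folklore] -/
theorem HasFiniteSpecificEntropy.exists_specificRelativeEntropy_le
    {ν μ : Measure (PointConfig (𝔼 × 𝔼))} (h : HasFiniteSpecificEntropy ν μ) :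
    ∃ C : ℝ≥0, specificRelativeEntropy ν μ ≤ C := by
  obtain ⟨C, hC⟩ := h
  refine ⟨C, limsup_le_of_le (by isBoundedDefault) (eventually_atTop.2 ⟨1, fun n hn => ?_⟩)⟩
  have hn' : (0 : ℝ) < n := by exact_mod_cast hn
  exact ENNReal.div_le_of_le_mul (hC _ _ fun _ => neg_lt_self hn')

/-- **Finite specific entropy implies `s(ν | μ) < ∞`.** [folklore] -/
theorem HasFiniteSpecificEntropy.specificRelativeEntropy_lt_top
    {ν μ : Measure (PointConfig (𝔼 × 𝔼))} (h : HasFiniteSpecificEntropy ν μ) :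
    specificRelativeEntropy ν μ < ∞ := by
  obtain ⟨C, hC⟩ := h.exists_specificRelativeEntropy_le
  exact hC.trans_lt ENNReal.coe_lt_top

/-- Finite specific entropy implies `s(ν | μ) ≠ ∞`. [folklore] -/
theorem HasFiniteSpecificEntropy.specificRelativeEntropy_ne_top
    {ν μ : Measure (PointConfig (𝔼 × 𝔼))} (h : HasFiniteSpecificEntropy ν μ) :
    specificRelativeEntropy ν μ ≠ ∞ :=
  h.specificRelativeEntropy_lt_top.ne

/-! ### Intensity of the vacuum; locally finite intensity; specific kinetic energy -/

/-- The vacuum `δ_∅` has intensity `0`. [folklore] -/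
@[simp] theorem intensity_dirac_empty :
    intensity (Measure.dirac (∅ : PointConfig (𝔼 × 𝔼))) = 0 := by
  rw [intensity, lintegral_dirac' _ (measurable_count_window measurableSet_unitCube)]
  simp

/-- **Locally finite intensity** ("`P` is of first order", Georgii–Zessin 1993 §2.1: `P(N_Λ) < ∞`
for each bounded region `Λ`): the expected number of particles with position in any bounded
measurable region is finite. [cite: GeorgiiZessin1993, §2.1] -/
def HasLocallyFiniteIntensity (ν : Measure (PointConfig (𝔼 × 𝔼))) : Prop :=
  ∀ Λ : Set 𝔼, MeasurableSet Λ → IsBounded Λ →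
    ∫⁻ ω, ((ω.count (window Λ) : ℕ∞) : ℝ≥0∞) ∂ν ≠ ∞

/-- Locally finite intensity gives a finite intensity. [folklore] -/
theorem HasLocallyFiniteIntensity.intensity_ne_top {ν : Measure (PointConfig (𝔼 × 𝔼))}
    (h : HasLocallyFiniteIntensity ν) : intensity ν ≠ ∞ :=
  h _ measurableSet_unitCube isBounded_unitCube

omit [Fintype d] in
/-- The vacuum `δ_∅` has locally finite intensity. [folklore] -/
theorem hasLocallyFiniteIntensity_dirac_empty :
    HasLocallyFiniteIntensity (Measure.dirac (∅ : PointConfig (𝔼 × 𝔼))) := by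
  intro Λ hΛ _
  rw [lintegral_dirac' _ (measurable_count_window hΛ)]
  simp

/-- **Kinetic energy in a window**: `Σ_{(q, v) ∈ ω, q ∈ Λ} ‖v‖² / 2 ∈ [0, ∞]` (mass `1`), the sum
over the (possibly infinitely many) particles of `ω` with position in `Λ` (Liverani–Olla 1996 §1,
the kinetic part of the energy `E_Λ`). [cite: LiveraniOlla1996, §1] -/
def kineticEnergyIn (Λ : Set 𝔼) (ω : PointConfig (𝔼 × 𝔼)) : ℝ≥0∞ :=
  ∑' p : ↥((ω : Set (𝔼 × 𝔼)) ∩ window Λ), ENNReal.ofReal (‖(p : 𝔼 × 𝔼).2‖ ^ 2 / 2)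

/-- Unfolding lemma for `kineticEnergyIn`. [folklore] -/
theorem kineticEnergyIn_def (Λ : Set 𝔼) (ω : PointConfig (𝔼 × 𝔼)) :
    kineticEnergyIn Λ ω =
      ∑' p : ↥((ω : Set (𝔼 × 𝔼)) ∩ window Λ), ENNReal.ofReal (‖(p : 𝔼 × 𝔼).2‖ ^ 2 / 2) :=
  rfl

/-- The empty configuration carries no kinetic energy. [folklore] -/
@[simp] theorem kineticEnergyIn_empty (Λ : Set 𝔼) :
    kineticEnergyIn Λ (∅ : PointConfig (𝔼 × 𝔼)) = 0 := by
  have h : ((∅ : PointConfig (𝔼 × 𝔼)) : Set (𝔼 × 𝔼)) ∩ window Λ = ∅ := by simp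
  rw [kineticEnergyIn, h]
  exact tsum_empty

/-- **Specific kinetic energy** of the law `ν`: the expected kinetic energy carried by the particles
with position in the unit cell `[0, 1)^d`, in `[0, ∞]` (the per-unit-volume kinetic energy of a
translation-invariant state; Liverani–Olla 1996 §1, `e(ω) = lim |Λ|⁻¹ E_Λ`).
[cite: LiveraniOlla1996, §1] -/
def specificKineticEnergy (ν : Measure (PointConfig (𝔼 × 𝔼))) : ℝ≥0∞ :=
  ∫⁻ ω, kineticEnergyIn unitCube ω ∂ν

/-- Unfolding lemma for `specificKineticEnergy`. [folklore] -/
theorem specificKineticEnergy_def (ν : Measure (PointConfig (𝔼 × 𝔼))) :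
    specificKineticEnergy ν = ∫⁻ ω, kineticEnergyIn unitCube ω ∂ν :=
  rfl

/-! ### Existence of the specific entropy relative to the free gas (named fact) -/

/-- **Existence of the specific entropy** (Georgii–Zessin 1993 §2.3 (2.12) and Remark 2.5 (1); the
unmarked original is Robinson–Ruelle 1967, cf. Ruelle 1969 Prop. 7.2.7: "the following limit exists
when `Λ → ∞` in the sense of Van Hove `s = lim S(Λ)/V(Λ)`").  Setting of the source: mark space
`E` Polish with a finite a priori measure `μ`, `μ(E) > 0`; `Q` the Poisson point random field on
`ℝ^d × E` with intensity `λ ⊗ μ`; `P` a stationary (translation-invariant) simple marked point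
random field of first order (finite expected particle number in bounded regions); `(Λ_n)` open
cubes increasing to `ℝ^d`.  Then "the (negative) specific entropy
`I(P) = lim_{n → ∞} |Λ_n|⁻¹ I(P_{Λ_n}; Q_{Λ_n})`" exists, "`I(P) = sup_{Λ ∈ 𝒞} |Λ|⁻¹ I(P_Λ; Q_Λ)`"
over the open cubes `𝒞 = {∏ᵢ (qᵢ, qᵢ + p)}`, "in particular, `I(P)` does not depend on the choice
of the sequence `(Λ_n)`".  Here: marks = velocities in `ℝ^d` with a finite nonzero mark measure
`m` (e.g. `z ·` Maxwellian), `π` a Poisson process with intensity `Leb ⊗ m` in the sense of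
`Literature.Analysis.FunctionSpaces.IsPoissonPointProcess`, cubes `Λ_n = (-n, n)^d`, and the
statement is made on the tree's phase-space configurations, on which such `ν` and `π` are carried
by the spatially locally finite configurations of the source.
[cite: GeorgiiZessin1993, §2.3 (2.12) and Remark 2.5 (1)] -/
def GeorgiiZessin1993_specificEntropy : Prop :=
  ∀ (m : Measure 𝔼) [IsFiniteMeasure m], m ≠ 0 →
    ∀ π ν : Measure (PointConfig (𝔼 × 𝔼)),
      IsPoissonPointProcess ((volume : Measure 𝔼).prod m) π → IsProbabilityMeasure ν →
      IsTranslationInvariant ν → HasLocallyFiniteIntensity ν →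
        Tendsto (fun n : ℕ => windowRelEntropy (cube (n : ℝ)) ν π / volume (cube (n : ℝ) : Set 𝔼))
            atTop (𝓝 (specificRelativeEntropy ν π)) ∧
          specificRelativeEntropy ν π =
            ⨆ (a : d → ℝ) (ℓ : ℝ) (_ : 0 < ℓ),
              windowRelEntropy (box a fun i => a i + ℓ) ν π /
                volume (box a (fun i => a i + ℓ) : Set 𝔼)

end Finite

end Literature.MathematicalPhysics.StatisticalMechanics

end
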